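/-
Copyright (c) 2026 the pub-hodgecm-mathlib formalisation cell (harness21).  Prover seat hodgecm-mathlib-F0P3a-p08 (g27): ROAD «UP-TR» (LEAD T14-21 «A»,
holder F0P3-p02 (g23), road file `ROAD-UP-TR.v2` §B), brick (N2b′) «EMB-FAMILY».
-/
import Literature.NumberTheory.Rogawski1990.LocalEndoscopicTorusTransport                 -- ★ (Θ) `exists_localEndoCentralizerEquiv_normPair`
import Literature.NumberTheory.Rogawski1990.LocalNormFibreTorusUniform                    -- ★ `mem_range_endoGL_of_commute` (block-diagonal commutant); brings ★ `LocalNormFibreNonsplit`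
import Literature.NumberTheory.Rogawski1990.LocalStableClassesNonsplitTypeOneOfCharpoly    -- ★ type (1): `exists_eigenframe_of_charpoly_eq_prod`, `finite_conjClassesIn_of_charpoly`
import Literature.NumberTheory.Rogawski1990.LocalStableClassesNonsplitTypeTwoCount         -- ★ type (2): `finite_conjClassesIn_of_blockFrame`
import Literature.NumberTheory.Rogawski1990.StableClassesSplitTorus                        -- ★ split: `isConj_of_isStablyConj_of_splitFrame_three`
import Literature.NumberTheory.Rogawski1990.UnitFundamentalLemmaInertIrredClauseOfValuesStubFrame  -- ★ `mul_eq_mul_reindex_fromBlocks_of_conj_endoEmbLocal_eq` (the block frame of `ι_v`)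
import Summits.HodgeConjecture.HodgeConjecture.Theorems.F0P3cStCharTSFibreRealise          -- ★ `invariants_of_norm_one_root` (unitary reciprocity of `charpoly` on `Gqs L v`)
import Summits.HodgeConjecture.HodgeConjecture.Theorems.F0P3cStCharTSWeylCartanRadial      -- ★ (E0) `centralizer_eq_of_mem_centralizer_of_isRegularElt`, `mul_eq_mul_iff_commute_val` (G side)
import Literature.NumberTheory.Automorphic.LocalRegularOrbitClosed                         -- ★ `map_conjLocal_transpose_localForm`, `isUnit_det_localForm`
import Literature.NumberTheory.Automorphic.Liu2021.LemD1AsPrintedIndexedNonVacuityNonsplitPlace  -- ★ `isField_localRing_of_nonsplit`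
import Literature.NumberTheory.Weil1982.UnitaryLocalRingBaseField                        -- ★ `exists_complexConj_eq_neg_ne_zero` (a purely imaginary `δ ≠ 0`)
import HarnessLib

/-!
# F0 · P3c · ROAD «UP-TR», brick (N2b′) «EMB-FAMILY»: the embeddings of an `H`-Cartan `Z_H(γ₀)` into `G = U(Φ₃)(L⁺_v)` — a finite transversal `S` of the
# `G`-classes over `ι_v(γ₀)` and the isomorphisms `e γ : Z_H(γ₀) ≃ₜ* Z_G(γ)` (`γ ∈ S`), exhausting and separating the matches of EVERY `G`-regular point of the torus
# (Rogawski 1990, §3.5 Prop. 3.5.2, §4.3 pp. 42–44, §5.4 p. 78, §12.5 Lemma 12.5.1)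
Cell `pub/hodgecm-mathlib`, crux H413 = `stmt-HodgeConjecture-24833` (lane `--kind proof --supports … --as helper`); seat F0P3a-p08 (g27).  ROAD «UP-TR» = the in-house
pay-down of `hUpTr` (clause 3 of `Ch12Sec5.EllipticData.UpSpec`, [Rogawski1990, §12.5 p. 183, L. 12.5.1]); architecture `F0/P3/F0P3-p02/g23/ROAD-UP-TR.v2.F0P3p02g23.md`
§A (everything parametrised by `H`-tori); this file is row (N2b′) of its §B, the input of (A-2) CLAIM-P ∕ (A-3) (the sum over `ψ ∈ Emb(T_H)`).  THEOREMS ONLY (no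
definition ∕ instance ∕ notation ∕ named fact ∕ `sorry`); ★-only imports.  HONEST LABEL (UP-TR): count-neutral; block consequents 11 → 10 → 9 only at the rider editions;
organs 2 = 2; h413 registry untouched; HC_CM is proved only modulo the printed citations until rung 0 closes.  This file proves no printed statement.
`v` non-split, `H_v = U(Φ₂)(L⁺_v) × U(Φ₁)(L⁺_v)`, `G = Gqs L v`, `ι_v : H_v ↪ G` (★ `endoEmbLocal`), matching `γ_H ↔ γ` = `GL₃(E_v)`-conjugacy of `ι_v(γ_H)` and `γ`
(★ `IsLocalNormPair`); `γ₀ ∈ H_v` `G`-regular, `T_H = Z_H(γ₀)`.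
§1 THE `G`-CLASSES OVER `ι_v(γ₀)` ARE FINITELY MANY (`finite_conjClassesIn_endoEmbLocal`, transversal `exists_finset_transversal_matches`): the matches of `γ₀` are the
local stable class of `ι_v(γ₀)`; by the trichotomy of `χ_g` (`γ₀ = (g, u)`) over the field `E_v`, read on the unitary reciprocity `charpoly ι_v(γ₀) = (X² − tX + d)(X − u)`,
`σd·d = 1`, `σt·d = t` (★ `invariants_of_norm_one_root`): two norm-one roots — type (1), four classes (★ `finite_conjClassesIn_of_charpoly`); a hyperbolic pair `a, σ(a)⁻¹`
— split, ONE class (★ `isConj_of_isStablyConj_of_splitFrame_three`, eigenframe ★ `exists_eigenframe_of_charpoly_eq_prod`); no root — type (2), two classes (★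
`finite_conjClassesIn_of_blockFrame` on the block frame of `ι_v`, ★ `mul_eq_mul_reindex_fromBlocks_of_conj_endoEmbLocal_eq`) [§3.5 Prop. 3.5.2 (c), §3.6].
§2 ALONG THE TORUS: (★ (Θ) `e γ z = y ι_v(z) y⁻¹` for ANY conjugator `y` of `ι_v(γ₀)` onto `γ`.)  EXHAUSTION: if `y ι_v(s) y⁻¹ = γ′ ∈ G` (`s ∈ T_H` `G`-regular) then
`y ι_v(γ₀) y⁻¹` is UNITARY (`conj_endoEmbLocal_mem_of_conj_eq` ⟸ ★ `conj_mem_unitaryGroup_of_conj_eq`), matches `γ₀`, is `G`-conjugate by some `k` to a `γc ∈ S`, and then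
`k⁻¹y` conjugates `ι_v(γ₀)` onto `γc`, so `e γc s = k⁻¹ γ′ k`.  INJECTIVITY: a `G`-conjugator `k` between `e γc s`, `e γc′ s` twists to `y_{c′}⁻¹ k y_c` commuting with the
regular `ι_v(s)`, hence with `ι_v(γ₀)` (★ `commute_of_commute_of_isRegularElt_local`), so `k γc k⁻¹ = γc′` (`conj_conj_eq_of_forall_commute`).  (vi) commuting regular
elements of `G` have the same centraliser (★ (E0)).  §3 THE HEAD `exists_embFamily` = ROAD-UP-TR v2 §B (N2b′) (i)–(vi) ((iv) at `G`-regular points — at `s = 1` all `e γ s = 1`).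
## References
* [Rogawski1990] J. D. Rogawski, *Automorphic Representations of Unitary Groups in Three Variables*, Ann. of Math. Stud. 123 (1990): §3.1 p. 19, §3.5 Prop. 3.5.2 p. 29,
  §3.6 p. 31, §4.3 pp. 42–44, §5.4 p. 78, §12.5 pp. 182–183 (Lemma 12.5.1).
* [LanglandsShelstad1987] R. P. Langlands, D. Shelstad, *On the definition of transfer factors*, Math. Ann. 278 (1987), §1.3.
-/

set_option autoImplicit false
-- the mandated namespace has the single-problem summit's repeated segment (`HodgeConjecture.HodgeConjecture`)
set_option linter.dupNamespace false
noncomputable section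
open NumberField IsDedekindDomain Matrix Polynomial
open scoped MatrixGroups
open Literature.NumberTheory.Rogawski1990 Literature.NumberTheory.Automorphic Literature.NumberTheory.Automorphic.UnitaryGroup
open Literature.AlgebraicGeometry.ShimuraVarieties (unitaryGroup)
open Summit.HodgeConjecture.HodgeConjecture.Cruxes.H413.F0P3cStCharTSFibreRealise (invariants_of_norm_one_root)
namespace Summit.HodgeConjecture.HodgeConjecture.Cruxes.H413.F0P3cStCharTSUpTrEmbFamily
variable (L : Type) [Field L] [NumberField L] [IsCMField L] (v : HeightOneSpectrum (𝓞 ↥(maximalRealSubfield L)))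
/-! ## §1 The `G`-classes over `ι_v(γ₀)`: finitely many, by the trichotomy of `χ_g` -/
section Classes
/-- **THE LOCAL STABLE CLASS OF `ι_v(γ₀)` IS A FINITE UNION OF `G`-CLASSES** (`γ₀ ∈ H_v` `G`-regular, `v` non-split): by the trichotomy of `χ_g` over the field
`E_v` — two norm-one roots (type (1): four classes), a hyperbolic pair (split torus: one class), no root (type (2): two classes).
[cite: Rogawski1990, §3.5 Prop. 3.5.2 (c) p. 29; §3.6 p. 31; §4.3 p. 43] -/
theorem finite_conjClassesIn_endoEmbLocal (hns : ∀ w : PlacesOver L v, IsCMField.complexConj L • w.1 = w.1)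
    (γ₀ : (cmDatum L 2 (Matrix.of fun i j : Fin 2 => if i.val + j.val + 1 = 2 then (1 : L) else 0)).Local v ×
      (cmDatum L 1 (Matrix.of fun i j : Fin 1 => if i.val + j.val + 1 = 1 then (1 : L) else 0)).Local v)
    (hreg : IsLocalGRegular L v γ₀) :
    (conjClassesIn (conjLocal L (IsCMField.complexConj L) v) (cmLocalForm L 3 v)
      ⟨((endoEmbLocal L v γ₀).val : GL (Fin 3) (LocalRing L v)), (endoEmbLocal L v γ₀).2⟩).Finite := by
  classical
  obtain ⟨w⟩ := (inferInstance : Nonempty (PlacesOver L v))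
  have hw := hns w
  obtain ⟨δ₁, hcδ, hδ⟩ := Literature.NumberTheory.Weil1982.UnitaryFinTopForm.exists_complexConj_eq_neg_ne_zero L
  letI : Field (LocalRing L v) :=
    (Liu2021.LemD1IndexedNonVacuityNonsplitPlace.isField_localRing_of_nonsplit L v (IsCMField.complexConj L) hcδ hδ w hw).toField
  -- the local hermitian data of `Φ₃`
  have hH := map_conjLocal_transpose_localForm L 3 (Matrix.of fun i j : Fin 3 => if i.val + j.val + 1 = 3 then (1 : L) else 0) v
    (antidiagOne_isHermitian L 3)
  have hHd := isUnit_det_localForm L 3 (Matrix.of fun i j : Fin 3 => if i.val + j.val + 1 = 3 then (1 : L) else 0) v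
    (isUnit_antidiagOne_det L 3).ne_zero
  -- notation
  set σ := conjLocal L (IsCMField.complexConj L) v with hσ
  set y : Gqs L v := endoEmbLocal L v γ₀ with hy
  set Y : Matrix (Fin 3) (Fin 3) (LocalRing L v) := (y.val : GL (Fin 3) (LocalRing L v)).val with hY
  set u : LocalRing L v := finGammaTwo L v γ₀ with hu
  set q : Polynomial (LocalRing L v) := finCharpolyTwo L v γ₀ with hq
  have hσσ : ∀ x, σ (σ x) = x := conjLocal_conjLocal_cm L v
  have hu1 : σ u * u = 1 := conjLocal_finGammaTwo_mul_finGammaTwo L v γ₀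
  have hchar : Y.charpoly = q * (X - C u) := charpoly_endoEmbLocal L v γ₀
  have hsep : Y.charpoly.Separable := hreg
  have hroot : Y.charpoly.IsRoot u := by
    rw [hchar, IsRoot, eval_mul, eval_sub, eval_X, eval_C, sub_self, mul_zero]
  -- unitary reciprocity: `charpoly y = (X² − tX + d)(X − u)`, `σd d = 1`, `σt d = t`; and `q = X² − tX + d`
  obtain ⟨hd, ht, hfac⟩ := invariants_of_norm_one_root L v y hroot hu1
  set t : LocalRing L v := Y.trace - u with ht'
  set d : LocalRing L v := Y.det * σ u with hd'
  have hqm : q.Monic := Matrix.charpoly_monic _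
  have hq2 : q = X ^ 2 - C t * X + C d := by
    have h := hfac.trans hchar
    exact (mul_right_cancel₀ (X_sub_C_ne_zero u) h).symm
  have hqdeg : q.natDegree = 2 := by unfold q finCharpolyTwo; exact Matrix.charpoly_natDegree_eq_dim _
  -- `d ≠ 0`
  have hd0 : d ≠ 0 := fun h0 => by rw [h0, mul_zero] at hd; exact zero_ne_one hd
  by_cases hex : ∃ a : LocalRing L v, q.IsRoot a
  · obtain ⟨a, ha⟩ := hex
    -- `q = (X − a)(X − b)` with `a + b = t`, `a b = d`
    set b : LocalRing L v := t - a with hb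
    have hab : a * b = d := by
      have h := ha
      rw [hq2, IsRoot, eval_add, eval_sub, eval_pow, eval_X, eval_mul, eval_C, eval_X, eval_C] at h
      rw [hb]; linear_combination -h
    have hqab : q = (X - C a) * (X - C b) := by
      have h1 : C t = C a + C b := by rw [← C_add, hb, add_sub_cancel]
      have h2 : C d = C a * C b := by rw [← C_mul, hab]
      rw [hq2, h1, h2]; ring
    have hchar3 : Y.charpoly = (X - C a) * (X - C b) * (X - C u) := by rw [hchar, hqab]
    have ha0 : a ≠ 0 := fun h0 => hd0 (by rw [← hab, h0, zero_mul])
    have hb0 : b ≠ 0 := fun h0 => hd0 (by rw [← hab, h0, mul_zero])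
    -- distinctness from separability
    have hsep3 : ((X - C a) * (X - C b) * (X - C u)).Separable := by rw [← hchar3]; exact hsep
    have hinj3 : Function.Injective ![a, b, u] := by
      have h3 : ((X - C a) * (X - C b) * (X - C u)) = ∏ i : Fin 3, (X - C (![a, b, u] i)) := by
        rw [Fin.prod_univ_three]; rfl
      rw [h3] at hsep3
      exact separable_prod_X_sub_C_iff.1 hsep3
    have hab' : a ≠ b := fun h0 => absurd (@hinj3 0 1 (by simp [h0])) (by decide)
    have hau : a ≠ u := fun h0 => absurd (@hinj3 0 2 (by simp [h0])) (by decide)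
    have hbu : b ≠ u := fun h0 => absurd (@hinj3 1 2 (by simp [h0])) (by decide)
    by_cases hna : σ a * a = 1
    · -- TYPE (1): `σb b = 1` as well, three norm-one roots
      have hnb : σ b * b = 1 := by
        have h1 : σ d * d = 1 := hd
        rw [← hab, map_mul] at h1
        have h2 : σ b * b * (σ a * a) = 1 := by linear_combination h1
        rwa [hna, mul_one] at h2
      have hchar' : Y.charpoly = ∏ i : Fin 3, (X - C (![a, b, u] i)) := by rw [hchar3, Fin.prod_univ_three]; rfl
      have hnorm : ∀ i, σ (![a, b, u] i) * ![a, b, u] i = 1 := by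
        intro i; fin_cases i
        · exact hna
        · exact hnb
        · exact hu1
      exact finite_conjClassesIn_of_charpoly L v (IsCMField.complexConj L) hcδ hδ w hw hH hHd y.2 ![a, b, u] hinj3 hnorm hchar'
    · -- SPLIT: `σa = b⁻¹`, the stable class is ONE class
      have hσab : σ a * b = 1 := by
        -- `σa, σb` and `a⁻¹, b⁻¹` have the same elementary symmetric functions
        have h1 : σ d * d = 1 := hd
        have h2 : σ t * d = t := ht
        have hs : σ a + σ b = σ t := by rw [hb, map_sub]; ring
        have hp : σ a * σ b = σ d := by rw [← hab, map_mul]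
        -- `(σa·a − 1)(σa·b − 1) = 0`
        have key : (σ a * a - 1) * (σ a * b - 1) = 0 := by
          have e1 : σ a * σ b * (a * b) = 1 := by rw [hp, hab]; exact h1
          have e2 : (σ a + σ b) * (a * b) = a + b := by rw [hs, hab, h2, hb]; ring
          linear_combination (σ a) * e2 - e1 - 0 * hs
        rcases mul_eq_zero.1 key with h0 | h0
        · exact absurd (sub_eq_zero.1 h0) hna
        · exact sub_eq_zero.1 h0
      -- eigenframe in the order `(a, u, b)`, `b = σ(a)⁻¹`
      have hchar' : Y.charpoly = ∏ i : Fin 3, (X - C (![a, u, b] i)) := by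
        rw [hchar3, Fin.prod_univ_three]
        show (X - C a) * (X - C b) * (X - C u) = (X - C a) * (X - C u) * (X - C b)
        ring
      have hinj' : Function.Injective ![a, u, b] := by
        intro i j h
        fin_cases i <;> fin_cases j
        · rfl
        · exact absurd (by simpa using h) hau
        · exact absurd (by simpa using h) hab'
        · exact absurd (by simpa using h) (Ne.symm hau)
        · rfl
        · exact absurd (by simpa using h) (Ne.symm hbu)
        · exact absurd (by simpa using h) (Ne.symm hab')
        · exact absurd (by simpa using h) hbu
        · rfl
      obtain ⟨P, hP⟩ := exists_eigenframe_of_charpoly_eq_prod (y.val : GL (Fin 3) (LocalRing L v)) ![a, u, b] hinj' hchar'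
      -- the six unit conditions of the split frame (inverse-free: cancel the non-zero `σ`-factors)
      have hunit : ∀ x : LocalRing L v, x ≠ 1 → IsUnit (x - 1) := fun x hx => isUnit_iff_ne_zero.2 (sub_ne_zero.2 hx)
      have hσba : σ b * a = 1 := by
        have h := congrArg σ hσab
        rwa [map_mul, hσσ, map_one, mul_comm] at h
      have hσa0 : σ a ≠ 0 := left_ne_zero_of_mul_eq_one hσab
      have hσb0 : σ b ≠ 0 := left_ne_zero_of_mul_eq_one hσba
      have hσu0 : σ u ≠ 0 := left_ne_zero_of_mul_eq_one hu1
      have h00 : IsUnit (σ (![a, u, b] 0) * ![a, u, b] 0 - 1) := hunit (σ a * a) hna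
      have h01 : IsUnit (σ (![a, u, b] 0) * ![a, u, b] 1 - 1) :=
        hunit (σ a * u) fun h0 => hbu (mul_left_cancel₀ hσa0 (hσab.trans h0.symm))
      have h10 : IsUnit (σ (![a, u, b] 1) * ![a, u, b] 0 - 1) :=
        hunit (σ u * a) fun h0 => hau (mul_left_cancel₀ hσu0 (h0.trans hu1.symm))
      have h12 : IsUnit (σ (![a, u, b] 1) * ![a, u, b] 2 - 1) :=
        hunit (σ u * b) fun h0 => hbu (mul_left_cancel₀ hσu0 (h0.trans hu1.symm))
      have h21 : IsUnit (σ (![a, u, b] 2) * ![a, u, b] 1 - 1) :=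
        hunit (σ b * u) fun h0 => hau (mul_left_cancel₀ hσb0 (hσba.trans h0.symm))
      have h22 : IsUnit (σ (![a, u, b] 2) * ![a, u, b] 2 - 1) :=
        hunit (σ b * b) fun h0 => hab' (mul_left_cancel₀ hσb0 (hσba.trans h0.symm))
      -- every stably conjugate `δ` is conjugate: the class set is the singleton `{⟦y⟧}`
      refine Set.Finite.subset (Set.finite_singleton (ConjClasses.mk
        (⟨(y.val : GL (Fin 3) (LocalRing L v)), y.2⟩ : unitaryGroup σ (cmLocalForm L 3 v)))) fun c hc => ?_
      obtain ⟨δ, rfl⟩ := ConjClasses.exists_rep c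
      rw [Set.mem_singleton_iff, eq_comm, ConjClasses.mk_eq_mk_iff_isConj]
      exact isConj_of_isStablyConj_of_splitFrame_three σ _ hσσ hH hHd (mk_mem_conjClassesIn_iff.1 hc) P hP h00 h01 h10 h12 h21 h22
  · -- TYPE (2): `χ_g` irreducible, the block frame of `ι_v`
    have hroots : q.roots = 0 := by
      refine Multiset.eq_zero_of_forall_notMem fun a ha => hex ⟨a, ?_⟩
      exact (mem_roots hqm.ne_zero).1 ha
    have hirr : Irreducible q := (hqm.irreducible_iff_roots_eq_zero_of_degree_le_three (by omega) (by omega)).2 hroots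
    have hP := mul_eq_mul_reindex_fromBlocks_of_conj_endoEmbLocal_eq L (Matrix.of fun i j : Fin 3 => if i.val + j.val + 1 = 3 then (1 : L) else 0) γ₀
      (b := y) (c := 1) (by rw [one_mul, inv_one, mul_one])
    rw [Units.val_one] at hP
    exact finite_conjClassesIn_of_blockFrame L v (IsCMField.complexConj L) hcδ hδ endoPerm w hw hH hHd y.2 (P := 1) hP hirr
/-- A match of a `G`-regular `γ_H` is regular (the characteristic polynomial is a conjugation invariant). [cite: Rogawski1990, §4.3 p. 43] -/
theorem isLocalNormPair_and_isRegularElt_aux {γH : (cmDatum L 2 (Matrix.of fun i j : Fin 2 => if i.val + j.val + 1 = 2 then (1 : L) else 0)).Local v ×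
      (cmDatum L 1 (Matrix.of fun i j : Fin 1 => if i.val + j.val + 1 = 1 then (1 : L) else 0)).Local v} {γ : Gqs L v}
    (hreg : IsLocalGRegular L v γH) (hm : IsLocalNormPair L (qsForm L) v γH γ) : IsRegularElt (γ.val : GL (Fin 3) (LocalRing L v)) :=
  isRegularElt_of_isConj hm hreg
/-- **A FINITE TRANSVERSAL OF THE `G`-CLASSES OVER `ι_v(γ₀)`** (`γ₀ ∈ H_v` `G`-regular, `v` non-split): finitely many `γ ∈ G = U(Φ₃)(L⁺_v)` matching `γ₀`,
regular, pairwise NOT `G`-conjugate, such that every `γ′ ∈ G` matching `γ₀` is `G`-conjugate to one of them (§1 finiteness + one representative per class).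
[cite: Rogawski1990, §3.5 Prop. 3.5.2 (c) p. 29; §3.1 p. 19; §4.3 p. 43] -/
theorem exists_finset_transversal_matches (hns : ∀ w : PlacesOver L v, IsCMField.complexConj L • w.1 = w.1)
    (γ₀ : (cmDatum L 2 (Matrix.of fun i j : Fin 2 => if i.val + j.val + 1 = 2 then (1 : L) else 0)).Local v ×
      (cmDatum L 1 (Matrix.of fun i j : Fin 1 => if i.val + j.val + 1 = 1 then (1 : L) else 0)).Local v)
    (hreg : IsLocalGRegular L v γ₀) :
    ∃ S : Finset (Gqs L v),
      (∀ γ ∈ S, IsLocalNormPair L (qsForm L) v γ₀ γ ∧ IsRegularElt (γ.val : GL (Fin 3) (LocalRing L v))) ∧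
      (∀ γ ∈ S, ∀ γ' ∈ S, γ ≠ γ' → ¬ IsConj γ γ') ∧
      ∀ γ : Gqs L v, IsLocalNormPair L (qsForm L) v γ₀ γ → ∃ γc ∈ S, IsConj γc γ := by
  classical
  have hfin := finite_conjClassesIn_endoEmbLocal L v hns γ₀ hreg
  set y : Gqs L v := endoEmbLocal L v γ₀ with hy
  -- one representative per class
  have hrep : ∀ c : ConjClasses (Gqs L v), ∃ g : Gqs L v, ConjClasses.mk g = c := fun c => ConjClasses.exists_rep c
  choose rep hrep using hrep
  refine ⟨hfin.toFinset.image rep, fun γ hγ => ?_, fun γ hγ γ' hγ' hne => ?_, fun γ hm => ?_⟩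
  · -- matching and regularity of a representative
    obtain ⟨c, hc, rfl⟩ := Finset.mem_image.1 hγ
    have hc' := (Set.Finite.mem_toFinset hfin).1 hc
    have hc'' : ConjClasses.mk (rep c) ∈ conjClassesIn (conjLocal L (IsCMField.complexConj L) v) (cmLocalForm L 3 v)
        ⟨(y.val : GL (Fin 3) (LocalRing L v)), y.2⟩ :=
      Eq.subst (motive := fun x : ConjClasses (Gqs L v) => x ∈ conjClassesIn (conjLocal L (IsCMField.complexConj L) v) (cmLocalForm L 3 v)
        ⟨(y.val : GL (Fin 3) (LocalRing L v)), y.2⟩) (hrep c).symm hc'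
    have hst : IsStablyConj (conjLocal L (IsCMField.complexConj L) v) (cmLocalForm L 3 v)
        ⟨(y.val : GL (Fin 3) (LocalRing L v)), y.2⟩ (rep c) := mk_mem_conjClassesIn_iff.1 hc''
    have hm : IsLocalNormPair L (qsForm L) v γ₀ (rep c) := isConj_iff.2 (isStablyConj_iff.1 hst)
    exact ⟨hm, (isLocalNormPair_and_isRegularElt_aux L v hreg hm)⟩
  · -- distinct representatives are not conjugate
    obtain ⟨c, -, rfl⟩ := Finset.mem_image.1 hγ
    obtain ⟨c', -, rfl⟩ := Finset.mem_image.1 hγ'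
    intro hconj
    apply hne
    have : c = c' := by rw [← hrep c, ← hrep c']; exact ConjClasses.mk_eq_mk_iff_isConj.2 hconj
    rw [this]
  · -- exhaustion: a match of `γ₀` lies in the stable class of `ι_v(γ₀)`
    have hst : IsStablyConj (conjLocal L (IsCMField.complexConj L) v) (cmLocalForm L 3 v)
        ⟨(y.val : GL (Fin 3) (LocalRing L v)), y.2⟩ γ := isStablyConj_iff.2 (isConj_iff.1 hm)
    have hc : ConjClasses.mk γ ∈ conjClassesIn (conjLocal L (IsCMField.complexConj L) v) (cmLocalForm L 3 v)
        ⟨(y.val : GL (Fin 3) (LocalRing L v)), y.2⟩ := mk_mem_conjClassesIn_iff.2 hst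
    refine ⟨rep (ConjClasses.mk γ), Finset.mem_image.2 ⟨_, (Set.Finite.mem_toFinset hfin).2 hc, rfl⟩, ?_⟩
    exact ConjClasses.mk_eq_mk_iff_isConj.1 (hrep _)
end Classes
/-! ## §2 Along the torus: the transports `e γ : Z_H(γ₀) ≃ₜ* Z_G(γ)` exhaust and separate the matches of every `G`-regular point -/
section Torus
variable {L v}
/-- `G`-CONJUGATION FROM A COMMON CONJUGATOR: if `k ∈ G` and `x, x′ ∈ G` have `x′ = k x k⁻¹` in `GL₃`, then `x ∼ x′` in `G`. [cite: Rogawski1990, §3.1 p. 19] -/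
theorem isConj_of_val_eq (k x x' : Gqs L v)
    (h : (k.val : GL (Fin 3) (LocalRing L v)) * x.val * (k.val)⁻¹ = x'.val) : IsConj x x' := by
  refine isConj_iff.2 ⟨k, ?_⟩
  apply Subtype.ext
  show (k * x * k⁻¹).val = x'.val
  rw [← h]; rfl
/-- **UNITARITY ALONG A MATCH** (the `G`-side twin of ★ `exists_preimage_of_conj_eq_of_commute`): if `y ι_v(s) y⁻¹ = γ′ ∈ G` with `s ∈ Z_H(γ₀)` `G`-regular, then
`y ι_v(γ₀) y⁻¹ ∈ G` (★ `conj_mem_unitaryGroup_of_conj_eq`: the commutant of the regular `γ′` is commutative). [cite: Rogawski1990, §3.1 p. 19; §4.3 p. 43] -/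
theorem conj_endoEmbLocal_mem_of_conj_eq
    {γ₀ : (cmDatum L 2 (Matrix.of fun i j : Fin 2 => if i.val + j.val + 1 = 2 then (1 : L) else 0)).Local v ×
      (cmDatum L 1 (Matrix.of fun i j : Fin 1 => if i.val + j.val + 1 = 1 then (1 : L) else 0)).Local v}
    {s : Subgroup.centralizer ({γ₀} : Set ((cmDatum L 2 (Matrix.of fun i j : Fin 2 => if i.val + j.val + 1 = 2 then (1 : L) else 0)).Local v ×
      (cmDatum L 1 (Matrix.of fun i j : Fin 1 => if i.val + j.val + 1 = 1 then (1 : L) else 0)).Local v))}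
    (hs : IsLocalGRegular L v s.1) {γ' : Gqs L v} {y : GL (Fin 3) (LocalRing L v)}
    (hy : y * ((endoEmbLocal L v s.1).val : GL (Fin 3) (LocalRing L v)) * y⁻¹ = γ'.val) :
    y * ((endoEmbLocal L v γ₀).val : GL (Fin 3) (LocalRing L v)) * y⁻¹ ∈
      unitaryGroupOfForm (conjLocal L (IsCMField.complexConj L) v) (cmLocalForm L 3 v) := by
  have hU : IsUnit (cmLocalForm L 3 v) := isUnit_adelicForm_map_adeleToLocal L v (isUnit_antidiagOne_det L 3).ne_zero
  have hγ'reg : IsRegularElt (γ'.val : GL (Fin 3) (LocalRing L v)) := isRegularElt_of_isConj (isConj_iff.2 ⟨y, hy⟩) hs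
  have hzγ : ((endoEmbLocal L v γ₀).val : GL (Fin 3) (LocalRing L v)) * (endoEmbLocal L v s.1).val =
      (endoEmbLocal L v s.1).val * (endoEmbLocal L v γ₀).val := by
    have hc : s.1 * γ₀ = γ₀ * s.1 := Subgroup.mem_centralizer_singleton_iff.1 s.2
    have h := congrArg (fun x => ((endoEmbLocal L v x).val : GL (Fin 3) (LocalRing L v))) hc
    simp only [map_mul] at h
    exact h.symm
  exact conj_mem_unitaryGroup_of_conj_eq (conjLocal L (IsCMField.complexConj L) v) hU hU (endoEmbLocal L v s.1).2 γ'.2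
    (commute_of_commute_of_isRegularElt_local L v γ' hγ'reg) y hy (endoEmbLocal L v γ₀).2 hzγ
end Torus
section GroupAux
variable {G : Type*} [Group G]
/-- `(k⁻¹y) Z (k⁻¹y)⁻¹ = k⁻¹ (y Z y⁻¹) k`. [folklore] -/
theorem inv_mul_conj (k y Z : G) : k⁻¹ * y * Z * (k⁻¹ * y)⁻¹ = k⁻¹ * (y * Z * y⁻¹) * k := by group
/-- `k ((k⁻¹y) X (k⁻¹y)⁻¹) k⁻¹ = y X y⁻¹`. [folklore] -/
theorem conj_inv_mul_conj (k y X : G) : k * (k⁻¹ * y * X * (k⁻¹ * y)⁻¹) * k⁻¹ = y * X * y⁻¹ := by group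
/-- If `k` conjugates `y X y⁻¹` to `y′ X y′⁻¹` and the commutant of `X` commutes with `Z`, then `k` conjugates `y Z y⁻¹` to `y′ Z y′⁻¹`. [cite: Rogawski1990, §3.1 p. 19] -/
theorem conj_conj_eq_of_forall_commute {k y y' X Z : G} (hX : k * (y * X * y⁻¹) * k⁻¹ = y' * X * y'⁻¹)
    (hZX : ∀ B : G, B * X = X * B → B * Z = Z * B) : k * (y * Z * y⁻¹) * k⁻¹ = y' * Z * y'⁻¹ := by
  have hB : (y'⁻¹ * k * y) * X = X * (y'⁻¹ * k * y) := by
    calc (y'⁻¹ * k * y) * X = y'⁻¹ * (k * (y * X * y⁻¹) * k⁻¹) * (k * y) := by group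
      _ = y'⁻¹ * (y' * X * y'⁻¹) * (k * y) := by rw [hX]
      _ = X * (y'⁻¹ * k * y) := by group
  have hBZ := hZX _ hB
  calc k * (y * Z * y⁻¹) * k⁻¹ = y' * ((y'⁻¹ * k * y) * Z) * (y⁻¹ * k⁻¹) := by group
    _ = y' * (Z * (y'⁻¹ * k * y)) * (y⁻¹ * k⁻¹) := by rw [hBZ]
    _ = y' * Z * y'⁻¹ := by group
end GroupAux

/-! ## §3 The head: (N2b′) «EMB-FAMILY» of ROAD-UP-TR v2 §B, clauses (i)–(vi) -/
section Head
/-- **(N2b′) «EMB-FAMILY».**  `v` non-split, `γ₀ ∈ H_v` `G`-regular.  There are a finite transversal `S ⊂ G = U(Φ₃)(L⁺_v)` of the `G`-classes over `ι_v(γ₀)` and topological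
group isomorphisms `e γ : Z_H(γ₀) ≃ₜ* Z_G(γ)` (`γ ∈ S`; ★ (Θ) `exists_localEndoCentralizerEquiv_normPair`) with: (i) every `γ ∈ S` matches `γ₀` and is regular; (ii) `S` is
pairwise non-`G`-conjugate; (iii) EXHAUSTION ALONG THE TORUS — every `γ′ ∈ G` matching a `G`-regular `s ∈ Z_H(γ₀)` is `G`-conjugate to `e γc s` for some `γc ∈ S`; (iv)
INJECTIVITY ALONG THE TORUS — at a `G`-regular `s` the values `e γc s`, `e γc′ s` of distinct members are not `G`-conjugate; (v) POINTWISE `s ↔ e γ s`, the value formula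
`(e γ s) = y ι_v(s) y⁻¹` for ANY conjugator `y` of `ι_v(γ₀)` onto `γ`, and `e γ γ₀ = γ`; (vi) `Z_G(e γ s) = Z_G(γ)` for `G`-regular `s`.  The re-indexing of the norm fibres of
the points of the `G`-Cartans `ψ(T_H)` by the pairs `(γ, s)` that Lemma 12.5.1's change of variables needs ((A-2)∕(A-3) of the road file).
[cite: Rogawski1990, §3.5 Prop. 3.5.2 (c) p. 29; §4.3 pp. 42–44; §5.4 p. 78; §12.5 pp. 182–183] [cite: LanglandsShelstad1987, §1.3] -/
theorem exists_embFamily (hns : ∀ w : PlacesOver L v, IsCMField.complexConj L • w.1 = w.1)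
    (γ₀ : (cmDatum L 2 (Matrix.of fun i j : Fin 2 => if i.val + j.val + 1 = 2 then (1 : L) else 0)).Local v ×
      (cmDatum L 1 (Matrix.of fun i j : Fin 1 => if i.val + j.val + 1 = 1 then (1 : L) else 0)).Local v)
    (hreg : IsLocalGRegular L v γ₀) :
    ∃ (S : Finset (Gqs L v))
      (e : ∀ γ ∈ S, Subgroup.centralizer ({γ₀} : Set ((cmDatum L 2 (Matrix.of fun i j : Fin 2 => if i.val + j.val + 1 = 2 then (1 : L) else 0)).Local v ×
          (cmDatum L 1 (Matrix.of fun i j : Fin 1 => if i.val + j.val + 1 = 1 then (1 : L) else 0)).Local v)) ≃ₜ*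
        Subgroup.centralizer ({γ} : Set (Gqs L v))),
      -- (i) matches of `γ₀`, regular
      (∀ γ ∈ S, IsLocalNormPair L (qsForm L) v γ₀ γ ∧ IsRegularElt (γ.val : GL (Fin 3) (LocalRing L v))) ∧
      -- (ii) pairwise not `G`-conjugate
      (∀ γ ∈ S, ∀ γ' ∈ S, γ ≠ γ' → ¬ IsConj γ γ') ∧
      -- (iii) exhaustion along the torus
      (∀ s : Subgroup.centralizer ({γ₀} : Set ((cmDatum L 2 (Matrix.of fun i j : Fin 2 => if i.val + j.val + 1 = 2 then (1 : L) else 0)).Local v ×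
          (cmDatum L 1 (Matrix.of fun i j : Fin 1 => if i.val + j.val + 1 = 1 then (1 : L) else 0)).Local v)),
        IsLocalGRegular L v s.1 → ∀ γ' : Gqs L v, IsLocalNormPair L (qsForm L) v s.1 γ' → ∃ γc, ∃ hc : γc ∈ S, IsConj (e γc hc s).1 γ') ∧
      -- (iv) injectivity along the torus (at `G`-regular points)
      (∀ s : Subgroup.centralizer ({γ₀} : Set ((cmDatum L 2 (Matrix.of fun i j : Fin 2 => if i.val + j.val + 1 = 2 then (1 : L) else 0)).Local v ×
          (cmDatum L 1 (Matrix.of fun i j : Fin 1 => if i.val + j.val + 1 = 1 then (1 : L) else 0)).Local v)),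
        IsLocalGRegular L v s.1 → ∀ γc (hc : γc ∈ S) γc' (hc' : γc' ∈ S), γc ≠ γc' → ¬ IsConj (e γc hc s).1 (e γc' hc' s).1) ∧
      -- (v) pointwise matching, the value formula, the base point
      (∀ γ (hγ : γ ∈ S) s, IsLocalNormPair L (qsForm L) v s.1 (e γ hγ s).1) ∧
      (∀ γ (hγ : γ ∈ S) (y : GL (Fin 3) (LocalRing L v)), y * ((endoEmbLocal L v γ₀).val : GL (Fin 3) (LocalRing L v)) * y⁻¹ = γ.val →
        ∀ s, (((e γ hγ s).1).val : GL (Fin 3) (LocalRing L v)) = y * ((endoEmbLocal L v s.1).val : GL (Fin 3) (LocalRing L v)) * y⁻¹) ∧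
      (∀ γ (hγ : γ ∈ S), (e γ hγ ⟨γ₀, Subgroup.mem_centralizer_singleton_iff.2 rfl⟩).1 = γ) ∧
      -- (vi) the same `G`-Cartan
      (∀ γ (hγ : γ ∈ S) s, IsLocalGRegular L v s.1 →
        Subgroup.centralizer ({(e γ hγ s).1} : Set (Gqs L v)) = Subgroup.centralizer ({γ} : Set (Gqs L v))) := by
  obtain ⟨S, hS, hpair, hexh⟩ := exists_finset_transversal_matches L v hns γ₀ hreg
  -- the transports (Θ), one per member of `S`
  have hΘ := fun γ (hγ : γ ∈ S) =>
    exists_localEndoCentralizerEquiv_normPair L v (H' := qsForm L) (isUnit_antidiagOne_det L 3).ne_zero hreg (hS γ hγ).1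
  choose e hval hmatch hregT using hΘ
  -- one conjugator of `ι_v(γ₀)` onto each member
  have hconj : ∀ γ ∈ S, ∃ y : GL (Fin 3) (LocalRing L v), y * ((endoEmbLocal L v γ₀).val : GL (Fin 3) (LocalRing L v)) * y⁻¹ = γ.val :=
    fun γ hγ => isConj_iff.1 (hS γ hγ).1
  choose yc hyc using hconj
  refine ⟨S, e, hS, hpair, fun s hs γ' hm => ?_, fun s hs γc hc γc' hc' hne hconj => ?_, fun γ hγ s => hmatch γ hγ s, fun γ hγ y hy s => hval γ hγ y hy s,
    fun γ hγ => ?_, fun γ hγ s hs => ?_⟩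
  · -- (iii) EXHAUSTION: `y ι(γ₀) y⁻¹ ∈ G` matches `γ₀`, is conjugate to some `γc ∈ S` by `k`; `k⁻¹ y` conjugates `ι(γ₀)` onto `γc`, so `e γc s = k⁻¹ γ′ k`
    obtain ⟨y, hy⟩ : ∃ y : GL (Fin 3) (LocalRing L v), y * ((endoEmbLocal L v s.1).val : GL (Fin 3) (LocalRing L v)) * y⁻¹ = γ'.val := isConj_iff.1 hm
    have hmem := conj_endoEmbLocal_mem_of_conj_eq hs hy
    obtain ⟨γc, hc, hk⟩ := hexh ⟨y * ((endoEmbLocal L v γ₀).val : GL (Fin 3) (LocalRing L v)) * y⁻¹, hmem⟩ (isConj_iff.2 ⟨y, rfl⟩)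
    obtain ⟨k, hk⟩ := isConj_iff.1 hk
    have hkv : (k.val : GL (Fin 3) (LocalRing L v)) * γc.val * (k.val)⁻¹ = y * ((endoEmbLocal L v γ₀).val : GL (Fin 3) (LocalRing L v)) * y⁻¹ :=
      congrArg Subtype.val hk
    -- `k⁻¹ y` conjugates `ι(γ₀)` onto `γc`
    have hk' : (k.val : GL (Fin 3) (LocalRing L v))⁻¹ * y * ((endoEmbLocal L v γ₀).val : GL (Fin 3) (LocalRing L v)) *
        ((k.val : GL (Fin 3) (LocalRing L v))⁻¹ * y)⁻¹ = γc.val := by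
      rw [inv_mul_conj, ← hkv]; group
    refine ⟨γc, hc, isConj_of_val_eq k _ _ ?_⟩
    rw [hval γc hc _ hk' s, conj_inv_mul_conj, hy]
  · -- (iv) INJECTIVITY: a `G`-conjugator between `e γc s` and `e γc′ s` twists to the commutant of the regular `ι(s)`, hence of `ι(γ₀)`
    obtain ⟨k, hk⟩ := isConj_iff.1 hconj
    have hk' : (k.val : GL (Fin 3) (LocalRing L v)) * ((e γc hc s).1).val * (k.val)⁻¹ = ((e γc' hc' s).1).val := congrArg Subtype.val hk
    rw [hval γc hc _ (hyc γc hc) s, hval γc' hc' _ (hyc γc' hc') s] at hk'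
    -- everything commuting with the regular `ι(s)` commutes with `ι(γ₀)`
    have hsγ : ((endoEmbLocal L v γ₀).val : GL (Fin 3) (LocalRing L v)) * (endoEmbLocal L v s.1).val =
        (endoEmbLocal L v s.1).val * (endoEmbLocal L v γ₀).val := by
      have hc0 : s.1 * γ₀ = γ₀ * s.1 := Subgroup.mem_centralizer_singleton_iff.1 s.2
      have h := congrArg (fun x => ((endoEmbLocal L v x).val : GL (Fin 3) (LocalRing L v))) hc0
      simp only [map_mul] at h
      exact h.symm
    have hZX : ∀ B : GL (Fin 3) (LocalRing L v), B * ((endoEmbLocal L v s.1).val : GL (Fin 3) (LocalRing L v)) = (endoEmbLocal L v s.1).val * B →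
        B * ((endoEmbLocal L v γ₀).val : GL (Fin 3) (LocalRing L v)) = (endoEmbLocal L v γ₀).val * B := by
      intro B hB
      have hcomm := commute_of_commute_of_isRegularElt_local L v (endoEmbLocal L v s.1) hs B.val
        ((endoEmbLocal L v γ₀).val : GL (Fin 3) (LocalRing L v)).val
        (by have h := congrArg Units.val hB; simp only [Units.val_mul] at h; exact h)
        (by have h := congrArg Units.val hsγ; simp only [Units.val_mul] at h; exact h)
      exact Units.ext hcomm.eq
    -- so `k γc k⁻¹ = γc′`
    have hkc : (k.val : GL (Fin 3) (LocalRing L v)) * γc.val * (k.val)⁻¹ = γc'.val := by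
      rw [← hyc γc hc, ← hyc γc' hc']
      exact conj_conj_eq_of_forall_commute hk' hZX
    exact hpair γc hc γc' hc' hne (isConj_of_val_eq k γc γc' hkc)
  · -- (v) base point: `e γ ⟨γ₀, _⟩ = γ` by the value formula at `γ₀`
    have h := hval γ hγ _ (hyc γ hγ) ⟨γ₀, Subgroup.mem_centralizer_singleton_iff.2 rfl⟩
    exact Subtype.ext (h.trans (hyc γ hγ))
  · -- (vi) `Z_G(e γ s) = Z_G(γ)`: commuting regular elements of `G`
    exact F0P3cStCharTSWeylCartanRadial.centralizer_eq_of_mem_centralizer_of_isRegularElt L v (hS γ hγ).2 (e γ hγ s).2 (hregT γ hγ s hs)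
end Head
end Summit.HodgeConjecture.HodgeConjecture.Cruxes.H413.F0P3cStCharTSUpTrEmbFamily
end
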